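import Mathlib
import Summits.MatrixMultiplication.MatrixMultiplication.Theorems.SoloBlindTypeModel
import Summits.MatrixMultiplication.MatrixMultiplication.Theorems.SoloBlindFamCheckerTwo

/-!
# Solo-blind seat (MatrixMultiplication), s85 — the type model over the version-two checker, and relabelling

(1) `soloBlind_typeModel_sem`: the semantic core of `soloBlind_typeModel` — the scaled mass of `τ` over `B ∪ X`
is dominated by the oracle objective of the slot set of all basis indices, so ANY sound bound on that objective
bounds the mass; `soloBlind_typeModelTwo` (+ `_kraft`, `_conjE`) instantiates it with `soloBlindFamCheckTwo_sound`.
(2) Relabelling of the outside points by `π : Equiv.Perm (Fin m)`: bitmask transport `soloBlindPermMask`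
(decode, push through `π`, re-encode; `soloBlindDecSet_permMask`, composition `soloBlindPermMask_comp`), family
transport `soloBlindPermFam`, the exact family of the relabelled enumeration (`soloBlindExactFam_perm`), a code
`soloBlindFamCode`, the tabulated canonicity test `soloBlindCanonB` used by the `m = 4` certificate, and
`soloBlind_exists_canon`: some relabelling of every family is canonical (a minimiser of the code over the finite
group).  So a certificate may restrict itself to canonical families.  Nothing here bears on `ω`.
-/

namespace Summit.MatrixMultiplication.MatrixMultiplication.Theorems

open Finset Module

variable {G : Type*} [AddCommGroup G] [DecidableEq G] {ι : Type*} [DecidableEq ι]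

/-! ## The semantic type model and its version-two instance -/

section Model

variable [Module (ZMod 3) G]

/-- THE TYPE MODEL, semantic form: a bound on the oracle objective of the slot set of all basis indices
bounds the scaled mass (this is the body of `soloBlind_typeModel`, with the checker factored out). -/
theorem soloBlind_typeModel_sem {h : ι → G} {B : Finset ι}
    (hli : LinearIndependent (ZMod 3) (fun i : B => h i))
    (hdist : ∀ A ⊆ B, ∀ A' ⊆ B, ∑ i ∈ A, h i = ∑ i ∈ A', h i → A = A')
    {m : ℕ} (x : Fin m ↪ ι) (hxB : ∀ a, x a ∉ B) (τ : G) (S bound : ℕ)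
    (hs : ((soloBlindExactFam h B x τ).map fun M => soloBlindPow2T S ((soloBlindDecSet m M).card +
      ((soloBlindSlotSet hli (soloBlindVec h x τ)).filter fun k => soloBlindR1Spec m k M = true).card)).sum ≤
      bound) :
    soloBlindMass h (B ∪ Finset.univ.map x) τ * 2 ^ S ≤ (bound : ℚ) := by
  set V := soloBlindSlotSet hli (soloBlindVec h x τ) with hV
  have hnodup : (soloBlindExactFam h B x τ).Nodup := List.nodup_range.filter _
  have hmass : soloBlindMass h (B ∪ Finset.univ.map x) τ =
      ∑ M ∈ (soloBlindExactFam h B x τ).toFinset, (1 / 2 : ℚ) ^ (soloBlindDecSet m M).card *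
        soloBlindMass h B (τ - ∑ a ∈ soloBlindDecSet m M, h (x a)) := by
    rw [soloBlind_mass_eq_sum_masks h B x hxB τ]
    symm
    apply Finset.sum_subset
    · intro M hM
      rw [List.mem_toFinset, soloBlind_mem_exactFam] at hM
      exact Finset.mem_range.mpr hM.1
    · intro M hM hMn
      rw [List.mem_toFinset, soloBlind_mem_exactFam, not_and] at hMn
      have habs := hMn (Finset.mem_range.mp hM)
      rw [Finset.not_nonempty_iff_eq_empty] at habs
      rw [soloBlind_mass_eq_zero_of_repAll_eq_empty habs, mul_zero]
  have hcast : (((soloBlindExactFam h B x τ).map fun M => soloBlindPow2T S ((soloBlindDecSet m M).card +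
      (V.filter fun k => soloBlindR1Spec m k M = true).card)).sum : ℚ) =
      ∑ M ∈ (soloBlindExactFam h B x τ).toFinset, (soloBlindPow2T S ((soloBlindDecSet m M).card +
        (V.filter fun k => soloBlindR1Spec m k M = true).card) : ℚ) := by
    rw [List.sum_toFinset _ hnodup, Nat.cast_list_sum, List.map_map]
    rfl
  calc soloBlindMass h (B ∪ Finset.univ.map x) τ * 2 ^ S
      = ∑ M ∈ (soloBlindExactFam h B x τ).toFinset, (1 / 2 : ℚ) ^ (soloBlindDecSet m M).card *
          soloBlindMass h B (τ - ∑ a ∈ soloBlindDecSet m M, h (x a)) * 2 ^ S := by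
        rw [hmass, Finset.sum_mul]
    _ ≤ ∑ M ∈ (soloBlindExactFam h B x τ).toFinset, (soloBlindPow2T S ((soloBlindDecSet m M).card +
          (V.filter fun k => soloBlindR1Spec m k M = true).card) : ℚ) := by
        refine Finset.sum_le_sum fun M _ => ?_
        calc (1 / 2 : ℚ) ^ (soloBlindDecSet m M).card *
              soloBlindMass h B (τ - ∑ a ∈ soloBlindDecSet m M, h (x a)) * 2 ^ S
            ≤ (1 / 2 : ℚ) ^ (soloBlindDecSet m M).card * (1 / 2 : ℚ) ^
                (V.filter fun k => soloBlindR1Spec m k M = true).card * 2 ^ S := by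
              gcongr
              exact soloBlind_mask_mass_le hli hdist x τ M
          _ = (1 / 2 : ℚ) ^ ((soloBlindDecSet m M).card +
                (V.filter fun k => soloBlindR1Spec m k M = true).card) * 2 ^ S := by rw [pow_add]
          _ ≤ _ := soloBlind_halfPow_mul_le S _
    _ = _ := hcast.symm
    _ ≤ _ := by exact_mod_cast hs

/-- THE TYPE MODEL over the version-two checker: acceptance of the exact presence family bounds the
scaled mass (same statement as `soloBlind_typeModel`). -/
theorem soloBlind_typeModelTwo {h : ι → G} {B : Finset ι}
    (hli : LinearIndependent (ZMod 3) (fun i : B => h i))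
    (hdist : ∀ A ⊆ B, ∀ A' ⊆ B, ∑ i ∈ A, h i = ∑ i ∈ A', h i → A = A')
    {m : ℕ} (x : Fin m ↪ ι) (hxB : ∀ a, x a ∉ B) (τ : G) (modeE : Bool) (S : ℕ) {look : Bool}
    (zsf : ∀ T ⊆ B ∪ Finset.univ.map x, T.Nonempty → ∑ i ∈ T, h i ≠ 0)
    (hgood : modeE = true → ∀ T ⊆ B ∪ Finset.univ.map x, ∑ i ∈ T, h i ≠ τ + τ)
    (hcheck : soloBlindFamCheckTwo (soloBlindMkTabs m) m S (soloBlindExactFam h B x τ) modeE look = true) :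
    soloBlindMass h (B ∪ Finset.univ.map x) τ * 2 ^ S ≤
      ((if modeE then 2 ^ (S - 1) else 2 ^ S : ℕ) : ℚ) :=
  soloBlind_typeModel_sem hli hdist x hxB τ S _
    (soloBlindFamCheckTwo_sound (fun _ hM => (soloBlind_mem_exactFam.mp hM).1) hcheck _
      (fun _ hk => soloBlind_slotSet_lt hli _ hk) (fun _ hk _ hM => soloBlind_slotSet_ok hli x τ hk hM)
      (fun _ hc => soloBlind_slotSet_hit hli x hxB τ modeE zsf hgood hc))

/-- THE TYPE MODEL over the version-two checker, (K₃) form: `mass(τ; B ∪ X) ≤ 1`. -/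
theorem soloBlind_typeModelTwo_kraft {h : ι → G} {B : Finset ι}
    (hli : LinearIndependent (ZMod 3) (fun i : B => h i))
    (hdist : ∀ A ⊆ B, ∀ A' ⊆ B, ∑ i ∈ A, h i = ∑ i ∈ A', h i → A = A')
    {m : ℕ} (x : Fin m ↪ ι) (hxB : ∀ a, x a ∉ B) (τ : G) (S : ℕ) {look : Bool}
    (zsf : ∀ T ⊆ B ∪ Finset.univ.map x, T.Nonempty → ∑ i ∈ T, h i ≠ 0)
    (hcheck : soloBlindFamCheckTwo (soloBlindMkTabs m) m S (soloBlindExactFam h B x τ) false look = true) :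
    soloBlindMass h (B ∪ Finset.univ.map x) τ ≤ 1 := by
  have e := soloBlind_typeModelTwo hli hdist x hxB τ false S zsf
    (fun hf => absurd hf Bool.false_ne_true) hcheck
  simp only [Bool.false_eq_true, if_false] at e
  push_cast at e
  exact le_of_mul_le_mul_right (by rwa [one_mul]) (pow_pos two_pos S)

/-- THE TYPE MODEL over the version-two checker, Conjecture E form (`S ≥ 1`): `mass(τ; B ∪ X) ≤ 1/2`. -/
theorem soloBlind_typeModelTwo_conjE {h : ι → G} {B : Finset ι}
    (hli : LinearIndependent (ZMod 3) (fun i : B => h i))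
    (hdist : ∀ A ⊆ B, ∀ A' ⊆ B, ∑ i ∈ A, h i = ∑ i ∈ A', h i → A = A')
    {m : ℕ} (x : Fin m ↪ ι) (hxB : ∀ a, x a ∉ B) (τ : G) {S : ℕ} (hS : 1 ≤ S) {look : Bool}
    (zsf : ∀ T ⊆ B ∪ Finset.univ.map x, T.Nonempty → ∑ i ∈ T, h i ≠ 0)
    (hgood : ∀ T ⊆ B ∪ Finset.univ.map x, ∑ i ∈ T, h i ≠ τ + τ)
    (hcheck : soloBlindFamCheckTwo (soloBlindMkTabs m) m S (soloBlindExactFam h B x τ) true look = true) :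
    soloBlindMass h (B ∪ Finset.univ.map x) τ ≤ 1 / 2 := by
  have e := soloBlind_typeModelTwo hli hdist x hxB τ true S zsf (fun _ => hgood) hcheck
  simp only [if_true] at e
  push_cast at e
  have h2 : (2 : ℚ) ^ S = 2 * 2 ^ (S - 1) := by rw [← pow_succ', Nat.sub_add_cancel hS]
  rw [h2, ← mul_assoc] at e
  have e2 : soloBlindMass h (B ∪ Finset.univ.map x) τ * 2 ≤ 1 :=
    le_of_mul_le_mul_right (by rwa [one_mul]) (pow_pos two_pos (S - 1))
  linarith

end Model

/-! ## Relabelling the outside points -/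

/-- Binary code of a finite set of naturals. -/
def soloBlindEnc (A : Finset ℕ) : ℕ := ∑ i ∈ A, 2 ^ i

/-- The bits of the code are the members. -/
theorem soloBlind_testBit_enc (A : Finset ℕ) (j : ℕ) : (soloBlindEnc A).testBit j = true ↔ j ∈ A := by
  unfold soloBlindEnc
  rw [← Nat.mem_bitIndices, ← List.mem_toFinset, Finset.toFinset_bitIndices_sum_two_pow]

/-- A set of naturals below `m` has code below `2^m`. -/
theorem soloBlindEnc_lt {A : Finset ℕ} {m : ℕ} (h : ∀ i ∈ A, i < m) : soloBlindEnc A < 2 ^ m :=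
  Nat.geomSum_lt (le_refl 2) h

/-- The relabelled bitmask: decode `M`, push the set through `π`, re-encode. -/
def soloBlindPermMask (m : ℕ) (π : Equiv.Perm (Fin m)) (M : ℕ) : ℕ :=
  soloBlindEnc (((soloBlindDecSet m M).map π.toEmbedding).map Fin.valEmbedding)

/-- Relabelled bitmasks stay below `2^m`. -/
theorem soloBlindPermMask_lt (m : ℕ) (π : Equiv.Perm (Fin m)) (M : ℕ) : soloBlindPermMask m π M < 2 ^ m :=
  soloBlindEnc_lt fun i hi => by
    rw [Finset.mem_map] at hi
    obtain ⟨a, -, rfl⟩ := hi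
    exact a.isLt

/-- The relabelled bitmask decodes to the image set. -/
theorem soloBlindDecSet_permMask (m : ℕ) (π : Equiv.Perm (Fin m)) (M : ℕ) :
    soloBlindDecSet m (soloBlindPermMask m π M) = (soloBlindDecSet m M).map π.toEmbedding := by
  ext b
  rw [soloBlind_mem_decSet, soloBlindPermMask, soloBlind_testBit_enc]
  exact Finset.mem_map' Fin.valEmbedding

/-- Relabelling is compatible with composition. -/
theorem soloBlindPermMask_comp (m : ℕ) (σ π : Equiv.Perm (Fin m)) (M : ℕ) :
    soloBlindPermMask m π (soloBlindPermMask m σ M) = soloBlindPermMask m (σ.trans π) M := by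
  apply soloBlindDecSet_inj (soloBlindPermMask_lt _ _ _) (soloBlindPermMask_lt _ _ _)
  simp only [soloBlindDecSet_permMask, Finset.map_map, Equiv.trans_toEmbedding]

/-- The relabelled family: masks whose relabelling lies in `F`. -/
def soloBlindPermFam (m : ℕ) (π : Equiv.Perm (Fin m)) (F : List ℕ) : List ℕ :=
  (List.range (2 ^ m)).filter fun M => decide (soloBlindPermMask m π M ∈ F)

/-- Membership in the relabelled family. -/
theorem soloBlind_mem_permFam {m : ℕ} {π : Equiv.Perm (Fin m)} {F : List ℕ} {M : ℕ} :
    M ∈ soloBlindPermFam m π F ↔ M < 2 ^ m ∧ soloBlindPermMask m π M ∈ F := by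
  unfold soloBlindPermFam
  rw [List.mem_filter, List.mem_range, decide_eq_true_eq]

/-- The relabelled family is a sublist of `range (2^m)`. -/
theorem soloBlindPermFam_sublist (m : ℕ) (π : Equiv.Perm (Fin m)) (F : List ℕ) :
    (soloBlindPermFam m π F).Sublist (List.range (2 ^ m)) := List.filter_sublist

/-- Relabelling families is compatible with composition. -/
theorem soloBlindPermFam_comp (m : ℕ) (σ π : Equiv.Perm (Fin m)) (F : List ℕ) :
    soloBlindPermFam m σ (soloBlindPermFam m π F) = soloBlindPermFam m (σ.trans π) F := by
  unfold soloBlindPermFam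
  apply List.filter_congr
  intro M _
  rw [decide_eq_decide, List.mem_filter, List.mem_range, decide_eq_true_eq, soloBlindPermMask_comp]
  exact ⟨fun h => h.2, fun h => ⟨soloBlindPermMask_lt _ _ _, h⟩⟩

omit [DecidableEq ι] in
/-- THE EXACT FAMILY OF A RELABELLED ENUMERATION is the relabelled exact family. -/
theorem soloBlindExactFam_perm (h : ι → G) (B : Finset ι) {m : ℕ} (x : Fin m ↪ ι)
    (π : Equiv.Perm (Fin m)) (τ : G) :
    soloBlindExactFam h B (π.toEmbedding.trans x) τ = soloBlindPermFam m π (soloBlindExactFam h B x τ) := by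
  unfold soloBlindPermFam soloBlindExactFam
  apply List.filter_congr
  intro M _
  rw [decide_eq_decide, List.mem_filter, List.mem_range, decide_eq_true_eq, soloBlindDecSet_permMask,
    Finset.sum_map]
  simp only [Function.Embedding.trans_apply, Equiv.coe_toEmbedding]
  exact ⟨fun hh => ⟨soloBlindPermMask_lt _ _ _, hh⟩, fun hh => hh.2⟩

omit [DecidableEq ι] in
/-- A relabelled enumeration enumerates the same set. -/
theorem soloBlind_map_perm_enum {m : ℕ} (x : Fin m ↪ ι) (π : Equiv.Perm (Fin m)) :
    Finset.univ.map (π.toEmbedding.trans x) = Finset.univ.map x := by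
  rw [← Finset.map_map, Finset.map_univ_equiv]

/-! ## Canonical families -/

/-- Code of a family of masks (injective on duplicate-free families). -/
def soloBlindFamCode (F : List ℕ) : ℕ := (F.map fun M => 2 ^ M).sum

/-- The relabelling tables: for each `π`, the array `M ↦ soloBlindPermMask m π M` (`M < 2^m`). -/
def soloBlindPermTabs (m : ℕ) : Multiset (Array ℕ) :=
  (Finset.univ : Finset (Equiv.Perm (Fin m))).val.map fun π =>
    Array.ofFn (n := 2 ^ m) fun M => soloBlindPermMask m π M

/-- The relabelled family read off a relabelling table. -/
def soloBlindPermFamA (m : ℕ) (A : Array ℕ) (F : List ℕ) : List ℕ :=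
  (List.range (2 ^ m)).filter fun M => decide (soloBlindNGet A M ∈ F)

/-- CANONICITY TEST: the code of `F` is minimal among its tabulated relabellings. -/
def soloBlindCanonB (m : ℕ) (P : Multiset (Array ℕ)) (F : List ℕ) : Bool :=
  decide (∀ A ∈ P, soloBlindFamCode F ≤ soloBlindFamCode (soloBlindPermFamA m A F))

/-- The table of `π` reproduces `soloBlindPermFam m π`. -/
theorem soloBlindPermFamA_ofFn (m : ℕ) (π : Equiv.Perm (Fin m)) (F : List ℕ) :
    soloBlindPermFamA m (Array.ofFn (n := 2 ^ m) fun M => soloBlindPermMask m π M) F =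
      soloBlindPermFam m π F := by
  unfold soloBlindPermFamA soloBlindPermFam
  apply List.filter_congr
  intro M hM
  rw [List.mem_range] at hM
  unfold soloBlindNGet
  rw [dif_pos (by simpa using hM), Array.getElem_ofFn]

/-- Canonicity against the full table set is canonicity against every relabelling. -/
theorem soloBlindCanonB_iff (m : ℕ) (F : List ℕ) :
    soloBlindCanonB m (soloBlindPermTabs m) F = true ↔
      ∀ π : Equiv.Perm (Fin m), soloBlindFamCode F ≤ soloBlindFamCode (soloBlindPermFam m π F) := by
  unfold soloBlindCanonB soloBlindPermTabs
  rw [decide_eq_true_eq]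
  constructor
  · intro hall π
    rw [← soloBlindPermFamA_ofFn]
    exact hall _ (Multiset.mem_map.mpr ⟨π, Finset.mem_univ _, rfl⟩)
  · intro hall A hA
    obtain ⟨π, -, rfl⟩ := Multiset.mem_map.mp hA
    rw [soloBlindPermFamA_ofFn]
    exact hall π

/-- SOME RELABELLING OF EVERY FAMILY IS CANONICAL (a minimiser of the code over the finite group). -/
theorem soloBlind_exists_canon (m : ℕ) (F : List ℕ) :
    ∃ π : Equiv.Perm (Fin m), soloBlindCanonB m (soloBlindPermTabs m) (soloBlindPermFam m π F) = true := by
  obtain ⟨π₀, -, hmin⟩ := Finset.exists_min_image Finset.univ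
    (fun π : Equiv.Perm (Fin m) => soloBlindFamCode (soloBlindPermFam m π F)) Finset.univ_nonempty
  refine ⟨π₀, (soloBlindCanonB_iff m _).mpr fun σ => ?_⟩
  rw [soloBlindPermFam_comp]
  exact hmin (σ.trans π₀) (Finset.mem_univ _)

end Summit.MatrixMultiplication.MatrixMultiplication.Theorems
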